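import Summits.CriticalPhenomena.CardyFormulaZ2.Theorems.CardySusyWardParafermionFamiliesToSLESixAnchorFamily

/-!
# Vocabulary (definitions module) of skeleton r4 of line `strip-anchored-vertex-normalisation`, II:
# the CONCRETE discretisation family of the anchor domain

Crux `CardySusyWard.ParafermionFamiliesToSLESix` (stmt-CriticalPhenomena-10814), skeleton r4
(`Cruxes/ParafermionFamiliesToSLESix/Lines/strip_anchored_vertex_normalisation.lean`), stub
`stub_anchorMoment_of_IP`.  The moment argument needs GLOBAL control of the discrete arcs of the anchor
family (every wall corner of `S_max` must be a regular touch of a straight wall up to `O(1)` exceptions), which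
an abstract `IsFamily` witness (`S5.exists_isFamily_anchor`, arcs only Hausdorff-close to the true arcs) does not
give.  This module fixes ONE concrete family of the diagonal square `S5.anchorDomain = {|x+y| < 2, |x−y| < 2}`
(free arc `arc 1` = the side `{x + y = 2}`, wired arc `arc 0` = the three other sides):

* `anchorArcB δ` — the part `{x + y = 2, |x − y| ≤ (L(δ) − 5/2)·δ}` of the free side, `L(δ) = ⌈2/δ⌉ − 1` the
  size of the lattice diamond at mesh `δ` (`L·δ < 2 ≤ (L+1)·δ`, as in `S5.anchor_geometry`);
* `anchorData δ` — the Dobrushin data with carrier `anchorDomain.carrier`, mesh `δ`, `arcB = anchorArcB δ` and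
  `arcA = frontier (carrier) \ anchorArcB δ`.

With the tree's frontier-distance rule (`zdDiscreteArc`) the discrete arcs of `anchorData δ` are then EXACTLY:
`zdArcB` = the free-layer boundary sites `v` (`L − 1 ≤ v₀ + v₁`) with `|v₀ − v₁| ≤ L − 3`, `zdArcA` = all other
boundary sites (the threshold `L − 5/2` is a half-integer in the lattice coordinate `v₀ − v₁`, so there are NO
ties at any mesh), the two `A`–`B` edges are `s((L−2,1),(L−1,1))` and `s((1,L−2),(1,L−1))`, and
`IsFamily anchorDomain anchorData` holds (Hausdorff distances `≤ 3δ`).  These facts are the registered sub-goals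
`stub_anchorData_*` proved in `…AnchorData*.lean`; nothing is asserted here.
-/

noncomputable section

namespace Summit.CriticalPhenomena.CardyFormulaZ2.Theorems.ParafermionFamiliesToSLESix.StripAnchored

open Literature.Probability.LatticeModels (DiscreteDobrushin)
open S5 (anchorDomain)

/-- The FREE ARC of the concrete anchor data at mesh `δ`: the points of the free side `{x + y = 2}` of the
diagonal square with `|x − y| ≤ (L(δ) − 5/2)·δ`, `L(δ) = ⌈2/δ⌉ − 1`.  (Empty for `δ > 4/5`; only `δ → 0⁺` matters.) -/
def anchorArcB (δ : ℝ) : Set ℂ :=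
  {z : ℂ | z.re + z.im = 2 ∧ |z.re - z.im| ≤ (((⌈2 / δ⌉ - 1 : ℤ) : ℝ) - 5 / 2) * δ}

/-- **The concrete anchor family**: Dobrushin data on `δℤ²` with carrier the diagonal square
`anchorDomain.carrier`, mesh `δ`, dual-wired (free) arc `anchorArcB δ` and wired arc the rest of the topological
boundary. -/
def anchorData (δ : ℝ) : DiscreteDobrushin where
  Ω := anchorDomain.carrier
  δ := δ
  arcA := frontier anchorDomain.carrier \ anchorArcB δ
  arcB := anchorArcB δ

/-- Definitional sanity (registered one-line form `stub_anchorData_defs`, so that this definitions module lands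
under `--supports`): the carrier and mesh fields of the concrete anchor data. -/
theorem stub_anchorData_defs : ∀ δ : ℝ, (anchorData δ).Ω = anchorDomain.carrier ∧ (anchorData δ).δ = δ :=
  fun _ => ⟨rfl, rfl⟩

end Summit.CriticalPhenomena.CardyFormulaZ2.Theorems.ParafermionFamiliesToSLESix.StripAnchored

end
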